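import Summits.BirchSwinnertonDyer.BirchSwinnertonDyer.Theorems.KolyvaginDepthDoorDepthTableRowKitSecondSign
import Summits.BirchSwinnertonDyer.BirchSwinnertonDyer.Theorems.KolyvaginDepthDoorDepthTableGlobalMinimal
import Summits.BirchSwinnertonDyer.BirchSwinnertonDyer.Theorems.KolyvaginDepthDoorDepthTableOddPrimeKit
import Summits.BirchSwinnertonDyer.BirchSwinnertonDyer.Theorems.Rank2ObservatoryKernelPrimes
import Summits.BirchSwinnertonDyer.BirchSwinnertonDyer.Theorems.Rank1ResidualIntModelReduction
import Summits.BirchSwinnertonDyer.Rank1Residual.Additive.PointCountEulerNat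
import Literature.NumberTheory.EllipticCurves.ComplexMultiplicationNotSemistable
import Literature.NumberTheory.EllipticCurves.RationalPointInfiniteOrderCriteria
import Mathlib.Tactic.NormNum.LegendreSymbol
import HarnessLib

/-!
# Route `KolyvaginDepthDoor` — DEPTH-TABLE ROWS ON THE SECOND SIGN, part 6: `77a1` `(5, -68, 29)`, `77a1` `(5, -131, 29)`
# (crux `KolyvaginDepthSupply`, stmt-BirchSwinnertonDyer-21765)

Helper file (`--supports stmt-BirchSwinnertonDyer-21765 --as helper`); it closes nothing and BSD is
not proved by it.

The route's depth table (g2–g9) has rows only on the crux's FIRST rank clause (`ν + 1 = rank E(ℚ)`,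
the 18 rank-2 and 9 rank-3 Cremona curves). This file fills rows on the SECOND clause
`ν = rank E(ℚ) = rank E^{(d_K)}(ℚ) − 1` with `ν = 1`: a RANK-ONE curve `E` and a Heegner field
`K = ℚ(√D)` for `N_E` whose quadratic twist `E^{(D)}` — a RANK-TWO elliptic curve over `ℚ` of conductor
`N_E·D²`, out of reach of every first-sign row through `K` (no Heegner hypothesis for `N_E D²`) — has
two independent rational points. Everything except the bit is decided in the kernel: `E` globally
minimal, non-CM (a multiplicative prime), `ρ̄_{E,p^m}` onto for all `m` (Mazur 6.3 witness + Serre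
Prop. 21 + a transvection), `p` good ordinary, the Heegner condition for `(Δ(E₀), D)`, the Kolyvagin
prime `ℓ` (`(D/ℓ) = −1`, `p ∣ ℓ + 1`, `p ∣ a_ℓ`), `1 ≤ rank_ℤ E(ℚ)` (a rational point with a denominator,
AEC VII.3.4) and `2 ≤ rank_ℤ E^{(D)}(ℚ)` (the tree's rational kernel certificate
`Rank2Observatory.two_le_mordellWeilRank_of_ratCert` on the twist model `[0, D b₂, 0, 8D²b₄, 16D³b₆]`
of the kit `…RowKitSecondSign`: two points found by a naive search, their chord, an odd torsion
annihilator from kernel point counts, doubling witnesses). Each row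
`SecondSign.C<label>.depthRow_<p>_neg<|D|>_<ℓ>_secondSign` takes ANY frame `(Dt, β, ι)` and ANY single
Kolyvagin–Heegner datum `d` of conductor `ℓ`, the ONE named input (γ) =
`GrossLMS1991.prop37_2_frobeniusCongruence` (Gross 1991 Prop. 3.7 (2); cite-only), and concludes from the
bit `d.kolyvaginClass _ 1 ≠ 0`: `corank_{ℤ_p} Ш(E)[p^∞] = 0`, `rank_ℤ E(ℚ) = 1`,
`corank_{ℤ_p} Ш(E^{(D)})[p^∞] = 0`, `rank_ℤ E^{(D)}(ℚ) = 2`, `E(ℚ)[p] = 0`, `Ш(E/ℚ)[p] = 0`,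
`#Sel^(p)(E/ℚ) = p`, `Ш(E^{(D)}/ℚ)[p] = 0`, `#Sel^(p)(E^{(D)}/ℚ) = p²`. CONDITIONAL on (γ) and the bit;
per-curve; BSD is not proved by it.

| curve | `Δ` | `p` (`a_p`) | `d_K` | `ℓ` (`a_ℓ`) | twist model | `P₁`, `P₂` on the twist model |
|---|---|---|---|---|---|---|
| `77a1` = `[0,0,1,2,0]` | `-539` | `5` (`-1`) | `-68` | `29` (`10`) | `[0,0,0,147968,-5030912]` | `(68, -2312)`, `(561/4, -34391/8)` |
| `77a1` = `[0,0,1,2,0]` | `-539` | `5` (`-1`) | `-131` | `29` (`10`) | `[0,0,0,549152,-35969456]` | `(1572, -68644)`, `(52924/121, -22583876/1331)` |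

References: [Kolyvagin1991MathAnn] Thm. 2.3; [GrossLMS1991] Prop. 3.7 (2), §5 (5.1), Prop. 6.2 (1);
[McCallumLMS1991] §§2–5; [Serre1972] §5.4 Prop. 21; [Mazur1978] §6 Prop. 6.3 (1);
[CremonaAlgorithms1997] Table 1, §2.4, §3.5; [SilvermanAEC2009] III.2.3, VII.3.1(b), VII.3.4, VIII.6.7,
X.5 Cor. 5.4; [Marcus1977] Ch. 3 Thm. 25; [JetchevLauterStein2009] §3.6 (arXiv:0707.0032).
-/

set_option linter.dupNamespace false

noncomputable section

open scoped Classical NumberField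

namespace Summit.BirchSwinnertonDyer.BirchSwinnertonDyer.Theorems.KolyvaginDepthDoor

open Literature.NumberTheory.EllipticCurves Literature.NumberTheory.EllipticCurves.ModularForms
  WeierstrassCurve
open Summit.BirchSwinnertonDyer.BirchSwinnertonDyer.Rank2Observatory
open Summit.BirchSwinnertonDyer.BirchSwinnertonDyer.Rank1Residual
open Summit.BirchSwinnertonDyer.Rank1Residual.Additive

namespace SecondSign

/-! ## Curve `77a1` = `[0,0,1,2,0]` (`Δ = -539`), rank one -/

namespace C77a1

/-- `77a1` = `[0,0,1,2,0]` is an elliptic curve over `ℚ` (`Δ = -539 ≠ 0`, kernel-checked).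
[cite: CremonaAlgorithms1997, Table 1 (77a1)] -/
theorem isElliptic : ((⟨0, 0, 1, 2, 0⟩ : WeierstrassCurve ℤ).map (Int.castRingHom ℚ)).IsElliptic := by
  rw [WeierstrassCurve.isElliptic_iff, WeierstrassCurve.map_Δ, isUnit_iff_ne_zero, eq_intCast,
    Int.cast_ne_zero]
  decide +kernel

/-- **`77a1` = `[0,0,1,2,0]` is a global minimal equation over `ℚ`** (`|Δ| = 539 < 3¹²`, `2¹² ∤ Δ`;
`isGloballyMinimal_map_int_of_natAbs_Δ_lt`, kernel-checked). [cite: CremonaAlgorithms1997, Table 1 (77a1)]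
[cite: SilvermanAEC2009, VII.1 Remark 1.1 and VIII.8] -/
theorem isGloballyMinimal : ((⟨0, 0, 1, 2, 0⟩ : WeierstrassCurve ℤ).map (Int.castRingHom ℚ)).IsGloballyMinimal :=
  isGloballyMinimal_map_int_of_natAbs_Δ_lt _ (by decide +kernel) (by decide +kernel) (by decide +kernel)

/-- The integral model of `77a1` is `[0,0,1,2,0]`. [cite: CremonaAlgorithms1997, Table 1 (77a1)] -/
theorem intModel :
    haveI := isGloballyMinimal;
    integralModelInt ((⟨0, 0, 1, 2, 0⟩ : WeierstrassCurve ℤ).map (Int.castRingHom ℚ)) = ⟨0, 0, 1, 2, 0⟩ := by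
  haveI := isGloballyMinimal
  exact IntModel.integralModelInt_eq_of_map_eq _ rfl

/-- `#Ẽ(𝔽_3) = 7`, `a_3 = -3` for `77a1`, kernel-decided (`ℕ`-arithmetic Euler count
`PointCountNat.natCard_point_map_eq`). [cite: CremonaAlgorithms1997, Table 1 (77a1) and §2.4] -/
theorem card_3 :
    Nat.card (((⟨0, 0, 1, 2, 0⟩ : WeierstrassCurve ℤ).map (Int.castRingHom (ZMod 3))).toAffine.Point) = 7 := by
  rw [PointCountNat.natCard_point_map_eq (hℓ := ⟨by norm_num⟩) (by norm_num) 0 0 1 2 0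
    (by decide +kernel)]
  decide +kernel

/-- `#Ẽ(𝔽_5) = 7`, `a_5 = -1` for `77a1`, kernel-decided (`ℕ`-arithmetic Euler count
`PointCountNat.natCard_point_map_eq`). [cite: CremonaAlgorithms1997, Table 1 (77a1) and §2.4] -/
theorem card_5 :
    Nat.card (((⟨0, 0, 1, 2, 0⟩ : WeierstrassCurve ℤ).map (Int.castRingHom (ZMod 5))).toAffine.Point) = 7 := by
  rw [PointCountNat.natCard_point_map_eq (hℓ := ⟨by norm_num⟩) (by norm_num) 0 0 1 2 0
    (by decide +kernel)]
  decide +kernel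

/-- `#Ẽ(𝔽_29) = 20`, `a_29 = 10` for `77a1`, kernel-decided (`ℕ`-arithmetic Euler count
`PointCountNat.natCard_point_map_eq`). [cite: CremonaAlgorithms1997, Table 1 (77a1) and §2.4] -/
theorem card_29 :
    Nat.card (((⟨0, 0, 1, 2, 0⟩ : WeierstrassCurve ℤ).map (Int.castRingHom (ZMod 29))).toAffine.Point) = 20 := by
  rw [PointCountNat.natCard_point_map_eq (hℓ := ⟨by norm_num⟩) (by norm_num) 0 0 1 2 0
    (by decide +kernel)]
  decide +kernel

/-- **`5 ∈ B(77a1)`: `ρ̄_{E,5^m}` is onto for every `m`** (unconditional): semistable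
(`gcd(c₄, Δ) = 1`), `X² − a_3 X + 3` with `a_3 = -3` root-free mod `5` (`E[5]` irreducible, Mazur
6.3; onto, Serre Prop. 21), and the multiplicative prime `11` with `11^1 ∥ Δ`, `5 ∤ 1` (a transvection
lifts the image to `GL₂(ℤ/5^m)`; `hasSurjectiveModNGaloisRep_pow_of_intModel_certificate`).
[cite: Serre1972, §5.4 Prop. 21] [cite: Mazur1978, §6 Prop. 6.3 (1)] [cite: SerreAbelianLadic1968, Ch. IV §3.4] -/
theorem hasSurjectiveModNGaloisRep_pow_5 (m : ℕ) :
    ((⟨0, 0, 1, 2, 0⟩ : WeierstrassCurve ℤ).map (Int.castRingHom ℚ)).HasSurjectiveModNGaloisRep (5 ^ m : ℕ) := by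
  have hn : ∀ t : ZMod 5, t ^ 2 - (((3 : ℕ) : ℤ) + 1 - (7 : ℕ) : ℤ) * t + ((3 : ℕ) : ZMod 5) ≠ 0 := by
    decide +kernel
  haveI := Fact.mk (by norm_num : Nat.Prime 5)
  haveI := Fact.mk (by norm_num : Nat.Prime 3)
  haveI := isElliptic
  haveI := isGloballyMinimal
  exact hasSurjectiveModNGaloisRep_pow_of_intModel_certificate intModel
    (by rw [Int.isCoprime_iff_gcd_eq_one]; decide +kernel) 5 3 (by norm_num) (by decide +kernel)
    (n := 7) card_3 hn 11 (by norm_num) (by norm_num) (by decide +kernel) (by decide +kernel)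
    (e := 1) (by decide +kernel) (by decide +kernel) (by decide +kernel) m

/-- **`5` is a prime of good ordinary reduction for `77a1`** (`5 ∤ Δ`, `a_5 = -1`) — the crux's
conditions on the witness prime. [cite: CremonaAlgorithms1997, Table 1 (77a1)] -/
theorem goodOrdinary_5 :
    haveI := Fact.mk (by norm_num : Nat.Prime 5);
    haveI := isGloballyMinimal;
    ((⟨0, 0, 1, 2, 0⟩ : WeierstrassCurve ℤ).map (Int.castRingHom ℚ)).HasGoodReductionAtPrime 5 ∧ ¬ ((5 : ℕ) : ℤ) ∣ ((⟨0, 0, 1, 2, 0⟩ : WeierstrassCurve ℤ).map (Int.castRingHom ℚ)).frobeniusTrace 5 := by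
  haveI := Fact.mk (by norm_num : Nat.Prime 5)
  haveI := isGloballyMinimal
  exact goodOrdinary_of_intModel_certificate intModel 5 (by decide +kernel) (n := 7) card_5
    (by decide +kernel)

/-- **`77a1` is not CM** (unconditional): multiplicative reduction at `11` (`11 ∣ Δ = -539`,
`11 ∤ c₄ = -96`), while a CM curve over `ℚ` has no multiplicative prime (integral `j`).
[cite: SilvermanATAEC1994, Thm. II.6.4 (PDF p. 148)] [cite: CremonaAlgorithms1997, Table 1 (77a1)] -/
theorem not_hasCM :
    haveI := isElliptic;
    ¬ ((⟨0, 0, 1, 2, 0⟩ : WeierstrassCurve ℤ).map (Int.castRingHom ℚ)).HasCM := by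
  haveI := isElliptic
  haveI := isGloballyMinimal
  haveI := Fact.mk (by norm_num : Nat.Prime 11)
  intro hCM
  exact not_hasMultiplicativeReductionAtPrime_of_hasCM _ hCM 11
    (IntModel.hasMultiplicativeReductionAtPrime_of_intModel intModel 11 (by decide +kernel)
      (by decide +kernel))

/-- **`1 ≤ rank_ℤ E(ℚ)` for `77a1` IN THE KERNEL** — kind-`NL` certificate: the rational point
`4·(0, 0) = (188/289, -9096/4913)` has `17 ∣ den(x)`, hence infinite order (AEC VII.3.4; tree
`one_le_mordellWeilRank_of_dvd_den`). [cite: SilvermanAEC2009, VII.3.4 and Thm. VIII.6.7]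
[cite: CremonaAlgorithms1997, Table 1 (77a1)] -/
theorem one_le_rank : 1 ≤ ((⟨0, 0, 1, 2, 0⟩ : WeierstrassCurve ℤ).map (Int.castRingHom ℚ)).mordellWeilRank := by
  haveI := isElliptic
  haveI := isGloballyMinimal
  haveI : Fact (Nat.Prime 17) := ⟨by norm_num⟩
  have hP : ((⟨0, 0, 1, 2, 0⟩ : WeierstrassCurve ℤ).map (Int.castRingHom ℚ)).toAffine.Nonsingular ((188 : ℚ) / 289) ((-9096 : ℚ) / 4913) :=
    WeierstrassCurve.Affine.equation_iff_nonsingular.mp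
      ((WeierstrassCurve.Affine.equation_iff _ _).mpr (by norm_num [WeierstrassCurve.map]))
  exact one_le_mordellWeilRank_of_dvd_den _ 17 (by norm_num) hP (by decide +kernel)


/-! ### Row `77a1`, `(p, d_K, ℓ) = (5, -68, 29)`: the twist `E^{(-68)}` has rank two -/

/-- **Heegner data `d_K = -68` for `77a1`**: every prime of `Δ = -539` (hence of `N_E`) splits in a
quadratic field of discriminant `-68` (Kronecker symbols `= 1`). [cite: Marcus1977, Ch. 3 Thm. 25]
[cite: GrossLMS1991, §1] -/
theorem heegner_neg68 : ∀ q : ℕ, q.Prime → (q : ℤ) ∣ (⟨0, 0, 1, 2, 0⟩ : WeierstrassCurve ℤ).Δ →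
    (q = 2 → (-68 : ℤ) % 8 = 1) ∧ (q ≠ 2 → jacobiSym (-68) q = 1) :=
  forall_prime_dvd_of_natAbs_eq_pow_mul_pow (a := 7) (i := 2) (b := 11) (j := 1) (by decide +kernel)
    (by norm_num) (by norm_num) ⟨by norm_num, by norm_num⟩ ⟨by norm_num, by norm_num⟩

/-- The twist model of the kit `…RowKitSecondSign` for `(77a1, D = -68)`:
`[0, D b₂, 0, 8 D² b₄, 16 D³ b₆] = ⟨0, 0, 0, 147968, -5030912⟩` (`ℚ`-isomorphic to `E^{(-68)}`, `u = 1/2`).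
[cite: SilvermanAEC2009, X.5 Cor. 5.4] -/
theorem twistModel_neg68 :
    (⟨0, (-68) * (⟨0, 0, 1, 2, 0⟩ : WeierstrassCurve ℤ).b₂, 0, 8 * (-68) ^ 2 * (⟨0, 0, 1, 2, 0⟩ : WeierstrassCurve ℤ).b₄, 16 * (-68) ^ 3 * (⟨0, 0, 1, 2, 0⟩ : WeierstrassCurve ℤ).b₆⟩ : WeierstrassCurve ℤ) =
      ⟨0, 0, 0, 147968, -5030912⟩ := by
  ext <;> decide +kernel

/-- Killers for the twist model `⟨0, 0, 0, 147968, -5030912⟩` of `E^{(-68)}` from the kernel counts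
`(q, #Ṽ(𝔽_q)) ∈ [(3, 7), (5, 5)]`. [cite: SilvermanAEC2009, Prop. VII.3.1(b)] -/
theorem killers_neg68 : ∀ ℓN ∈ [((3 : ℕ), (7 : ℕ)), (5, 5)], ℓN.1.Prime ∧
    ∀ (x : ((⟨0, 0, 0, 147968, -5030912⟩ : WeierstrassCurve ℤ).map (Int.castRingHom ℚ)).toAffine.Point)
      (n : ℕ), ¬ ℓN.1 ∣ n → n • x = 0 → ℓN.2 • x = 0 :=
  killers_cons _ (q := 3) (N := 7) (by decide +kernel) (by decide +kernel)
    (killers_cons _ (q := 5) (N := 5) (by decide +kernel) (by decide +kernel)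
    (killers_nil _))

/-- **`2 ≤ rank_ℤ E^{(-68)}(ℚ)` for `E = 77a1` IN THE KERNEL**, on the twist model `⟨0, 0, 0, 147968, -5030912⟩`: rational
kernel certificate `Rank2Observatory.two_le_mordellWeilRank_of_ratCert` with the points
`P₁ = (68, -2312)`, `P₂ = (561/4, -34391/8)` (found by a naive search on `d·η² = f(x)`), their chord
`P₁ + P₂ = (548, 15512)`, odd torsion annihilator `t = 1` from the counts at `q = 3, 5`, and doubling
witnesses at `q = 13, 13, 19` (residues `(3,2)`, `(7,9)`, `(16,8)`). Hence `P₁, P₂` are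
`ℤ`-independent. [cite: SilvermanAEC2009, III.2.3, Prop. VII.3.1(b) and Thm. VIII.6.7]
[cite: CremonaAlgorithms1997, §3.5] -/
theorem two_le_rank_twist_neg68 :
    2 ≤ ((⟨0, 0, 0, 147968, -5030912⟩ : WeierstrassCurve ℤ).map (Int.castRingHom ℚ)).mordellWeilRank :=
  two_le_mordellWeilRank_of_ratCert _ (x₁ := 68) (y₁ := -2312) (x₂ := 561/4) (y₂ := -34391/8)
    (x₃ := 548) (y₃ := 15512) (by decide +kernel) (by decide +kernel)
    (by decide +kernel) (by decide +kernel) (t := 1) (by decide) killers_neg68 (by decide +kernel)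
    13 13 19 (by decide +kernel) (by decide +kernel) (by decide +kernel) (by decide +kernel)
    (by decide +kernel) (by decide +kernel) 3 2 7 9 16 8 (by decide +kernel)
    (by decide +kernel) (by decide +kernel) (by decide +kernel) (by decide +kernel)
    (by decide +kernel)

/-- **SECOND-SIGN DEPTH-TABLE ROW `77a1`, `(p, d_K, ℓ) = (5, -68, 29)`, ON PRINT-STANDARD INPUTS.**
For `E = 77a1` (rank one), ANY imaginary quadratic `K` with `d_K = -68` (Heegner for `N_E`; the twist
`E^{(-68)}` has two independent rational points, certified in the kernel), any frame `(Dt, β, ι)` and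
ANY single Kolyvagin–Heegner datum `d` of conductor `29` (a Kolyvagin prime: `(-68/29) = −1`,
`5 ∣ 29 + 1`, `5 ∣ a_29 = 10`), granted the ONE Literature fact (γ) =
`GrossLMS1991.prop37_2_frobeniusCongruence` (Gross 1991 Prop. 3.7 (2); cite-only): IF
`d.kolyvaginClass _ 1 ≠ 0` (the row's bit), THEN `corank_{ℤ_5} Ш(E)[5^∞] = 0`, `rank_ℤ E(ℚ) = 1`,
`corank_{ℤ_5} Ш(E^{(-68)})[5^∞] = 0`, `rank_ℤ E^{(-68)}(ℚ) = 2`, `E(ℚ)[5] = 0`, `Ш(E/ℚ)[5] = 0`,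
`#Sel^(5)(E/ℚ) = 5`, `Ш(E^{(-68)}/ℚ)[5] = 0` and `#Sel^(5)(E^{(-68)}/ℚ) = 5²` — the crux's SECOND
rank clause `ν = rank E(ℚ) = rank E^{(d_K)}(ℚ) − 1` at this curve, and `Ш[5] = 0` for the RANK-TWO
curve `E^{(-68)}` (conductor `N_E·68²`), which no first-sign row reaches through `K`. Side conditions:
`ρ̄_{E,5^m}` onto (`hasSurjectiveModNGaloisRep_pow_5`), non-CM, Heegner, Kolyvagin prime
(`card_29`), (KN_5) from `Δ(E₀) = -539` (`decide`-able table), `1 ≤ rank` (`one_le_rank`),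
`2 ≤ rank E^{(-68)}` (`two_le_rank_twist_neg68`) — all kernel theorems. CONDITIONAL on (γ) and the
bit; per-curve; BSD is not proved by it. [cite: Kolyvagin1991MathAnn, Thm. 2.3]
[cite: GrossLMS1991, Prop. 3.7 (2), §5 (5.1), Prop. 6.2 (1)] [cite: McCallumLMS1991, §§2–5]
[cite: JetchevLauterStein2009, §3.6 (arXiv:0707.0032)] -/
theorem depthRow_5_neg68_29_secondSign
    (h372 : GrossLMS1991.prop37_2_frobeniusCongruence)
    (K : Type) [Field K] [NumberField K] (hK : IsImaginaryQuadratic K)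
    (hD : NumberField.discr K = -68) :
    haveI := isElliptic;
    haveI := isGloballyMinimal;
    haveI : NeZero (((⟨0, 0, 1, 2, 0⟩ : WeierstrassCurve ℤ).map (Int.castRingHom ℚ)).conductorNorm ℤ) := neZero_conductorNorm_of_isElliptic _;
    ∀ (Dt : ModularParametrizationData ((⟨0, 0, 1, 2, 0⟩ : WeierstrassCurve ℤ).map (Int.castRingHom ℚ)) (((⟨0, 0, 1, 2, 0⟩ : WeierstrassCurve ℤ).map (Int.castRingHom ℚ)).conductorNorm ℤ)) (β : ℤ) (ι : K →+* ℂ)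
      (d : KolyvaginHeegnerData Dt β ι 29),
    d.kolyvaginClass (p := 5) (by norm_num) 1 ≠ 0 →
    ((⟨0, 0, 1, 2, 0⟩ : WeierstrassCurve ℤ).map (Int.castRingHom ℚ)).shaCorank 5 = 0 ∧ ((⟨0, 0, 1, 2, 0⟩ : WeierstrassCurve ℤ).map (Int.castRingHom ℚ)).mordellWeilRank = 1 ∧
      (((⟨0, 0, 1, 2, 0⟩ : WeierstrassCurve ℤ).map (Int.castRingHom ℚ)).quadraticTwist ((-68 : ℤ) : ℚ)).shaCorank 5 = 0 ∧
      (((⟨0, 0, 1, 2, 0⟩ : WeierstrassCurve ℤ).map (Int.castRingHom ℚ)).quadraticTwist ((-68 : ℤ) : ℚ)).mordellWeilRank = 2 ∧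
      (∀ P : ((⟨0, 0, 1, 2, 0⟩ : WeierstrassCurve ℤ).map (Int.castRingHom ℚ)).toAffine.Point, 5 • P = 0 → P = 0) ∧
      (∀ x ∈ ((⟨0, 0, 1, 2, 0⟩ : WeierstrassCurve ℤ).map (Int.castRingHom ℚ)).sha, 5 • x = 0 → x = 0) ∧
      Nat.card ↥(selmerGroup ((⟨0, 0, 1, 2, 0⟩ : WeierstrassCurve ℤ).map (Int.castRingHom ℚ)) ((5 : ℕ) : ℤ)) = 5 ∧
      (∀ x ∈ (((⟨0, 0, 1, 2, 0⟩ : WeierstrassCurve ℤ).map (Int.castRingHom ℚ)).quadraticTwist ((-68 : ℤ) : ℚ)).sha, 5 • x = 0 → x = 0) ∧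
      Nat.card ↥(selmerGroup (((⟨0, 0, 1, 2, 0⟩ : WeierstrassCurve ℤ).map (Int.castRingHom ℚ)).quadraticTwist ((-68 : ℤ) : ℚ)) ((5 : ℕ) : ℤ)) = 5 ^ 2 := by
  haveI := isElliptic
  haveI := isGloballyMinimal
  haveI : NeZero (((⟨0, 0, 1, 2, 0⟩ : WeierstrassCurve ℤ).map (Int.castRingHom ℚ)).conductorNorm ℤ) := neZero_conductorNorm_of_isElliptic _
  intro Dt β ι d hne
  haveI := Fact.mk (by norm_num : Nat.Prime 5)
  exact depthRowSecondSign_print_of_datum_of_intModel_certificate intModel h372 not_hasCM one_le_rank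
    5 (by norm_num) hasSurjectiveModNGaloisRep_pow_5 K hK hD (by norm_num) (by norm_num)
    twistModel_neg68 two_le_rank_twist_neg68 heegner_neg68 29 (by norm_num) (by norm_num)
    (by decide +kernel) (by norm_num) (by norm_num) (by norm_num) (by norm_num) (n := 20) card_29
    (by norm_num) (Δ₀ := -539) (by decide +kernel) (B := 11) (by decide +kernel) (by decide +kernel)
    (fun _ _ ↦ Or.inl (by norm_num)) Dt β ι d hne


/-! ### Row `77a1`, `(p, d_K, ℓ) = (5, -131, 29)`: the twist `E^{(-131)}` has rank two -/

/-- **Heegner data `d_K = -131` for `77a1`**: every prime of `Δ = -539` (hence of `N_E`) splits in a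
quadratic field of discriminant `-131` (Kronecker symbols `= 1`). [cite: Marcus1977, Ch. 3 Thm. 25]
[cite: GrossLMS1991, §1] -/
theorem heegner_neg131 : ∀ q : ℕ, q.Prime → (q : ℤ) ∣ (⟨0, 0, 1, 2, 0⟩ : WeierstrassCurve ℤ).Δ →
    (q = 2 → (-131 : ℤ) % 8 = 1) ∧ (q ≠ 2 → jacobiSym (-131) q = 1) :=
  forall_prime_dvd_of_natAbs_eq_pow_mul_pow (a := 7) (i := 2) (b := 11) (j := 1) (by decide +kernel)
    (by norm_num) (by norm_num) ⟨by norm_num, by norm_num⟩ ⟨by norm_num, by norm_num⟩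

/-- The twist model of the kit `…RowKitSecondSign` for `(77a1, D = -131)`:
`[0, D b₂, 0, 8 D² b₄, 16 D³ b₆] = ⟨0, 0, 0, 549152, -35969456⟩` (`ℚ`-isomorphic to `E^{(-131)}`, `u = 1/2`).
[cite: SilvermanAEC2009, X.5 Cor. 5.4] -/
theorem twistModel_neg131 :
    (⟨0, (-131) * (⟨0, 0, 1, 2, 0⟩ : WeierstrassCurve ℤ).b₂, 0, 8 * (-131) ^ 2 * (⟨0, 0, 1, 2, 0⟩ : WeierstrassCurve ℤ).b₄, 16 * (-131) ^ 3 * (⟨0, 0, 1, 2, 0⟩ : WeierstrassCurve ℤ).b₆⟩ : WeierstrassCurve ℤ) =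
      ⟨0, 0, 0, 549152, -35969456⟩ := by
  ext <;> decide +kernel

/-- Killers for the twist model `⟨0, 0, 0, 549152, -35969456⟩` of `E^{(-131)}` from the kernel counts
`(q, #Ṽ(𝔽_q)) ∈ [(3, 7), (17, 20)]`. [cite: SilvermanAEC2009, Prop. VII.3.1(b)] -/
theorem killers_neg131 : ∀ ℓN ∈ [((3 : ℕ), (7 : ℕ)), (17, 20)], ℓN.1.Prime ∧
    ∀ (x : ((⟨0, 0, 0, 549152, -35969456⟩ : WeierstrassCurve ℤ).map (Int.castRingHom ℚ)).toAffine.Point)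
      (n : ℕ), ¬ ℓN.1 ∣ n → n • x = 0 → ℓN.2 • x = 0 :=
  killers_cons _ (q := 3) (N := 7) (by decide +kernel) (by decide +kernel)
    (killers_cons _ (q := 17) (N := 20) (by decide +kernel) (by decide +kernel)
    (killers_nil _))

/-- **`2 ≤ rank_ℤ E^{(-131)}(ℚ)` for `E = 77a1` IN THE KERNEL**, on the twist model `⟨0, 0, 0, 549152, -35969456⟩`: rational
kernel certificate `Rank2Observatory.two_le_mordellWeilRank_of_ratCert` with the points
`P₁ = (1572, -68644)`, `P₂ = (52924/121, -22583876/1331)` (found by a naive search on `d·η² = f(x)`), their chord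
`P₁ + P₂ = (65, 7)`, odd torsion annihilator `t = 1` from the counts at `q = 3, 17`, and doubling
witnesses at `q = 29, 19, 19` (residues `(6,28)`, `(4,18)`, `(8,7)`). Hence `P₁, P₂` are
`ℤ`-independent. [cite: SilvermanAEC2009, III.2.3, Prop. VII.3.1(b) and Thm. VIII.6.7]
[cite: CremonaAlgorithms1997, §3.5] -/
theorem two_le_rank_twist_neg131 :
    2 ≤ ((⟨0, 0, 0, 549152, -35969456⟩ : WeierstrassCurve ℤ).map (Int.castRingHom ℚ)).mordellWeilRank :=
  two_le_mordellWeilRank_of_ratCert _ (x₁ := 1572) (y₁ := -68644) (x₂ := 52924/121) (y₂ := -22583876/1331)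
    (x₃ := 65) (y₃ := 7) (by decide +kernel) (by decide +kernel)
    (by decide +kernel) (by decide +kernel) (t := 1) (by decide) killers_neg131 (by decide +kernel)
    29 19 19 (by decide +kernel) (by decide +kernel) (by decide +kernel) (by decide +kernel)
    (by decide +kernel) (by decide +kernel) 6 28 4 18 8 7 (by decide +kernel)
    (by decide +kernel) (by decide +kernel) (by decide +kernel) (by decide +kernel)
    (by decide +kernel)

/-- **SECOND-SIGN DEPTH-TABLE ROW `77a1`, `(p, d_K, ℓ) = (5, -131, 29)`, ON PRINT-STANDARD INPUTS.**
For `E = 77a1` (rank one), ANY imaginary quadratic `K` with `d_K = -131` (Heegner for `N_E`; the twist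
`E^{(-131)}` has two independent rational points, certified in the kernel), any frame `(Dt, β, ι)` and
ANY single Kolyvagin–Heegner datum `d` of conductor `29` (a Kolyvagin prime: `(-131/29) = −1`,
`5 ∣ 29 + 1`, `5 ∣ a_29 = 10`), granted the ONE Literature fact (γ) =
`GrossLMS1991.prop37_2_frobeniusCongruence` (Gross 1991 Prop. 3.7 (2); cite-only): IF
`d.kolyvaginClass _ 1 ≠ 0` (the row's bit), THEN `corank_{ℤ_5} Ш(E)[5^∞] = 0`, `rank_ℤ E(ℚ) = 1`,
`corank_{ℤ_5} Ш(E^{(-131)})[5^∞] = 0`, `rank_ℤ E^{(-131)}(ℚ) = 2`, `E(ℚ)[5] = 0`, `Ш(E/ℚ)[5] = 0`,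
`#Sel^(5)(E/ℚ) = 5`, `Ш(E^{(-131)}/ℚ)[5] = 0` and `#Sel^(5)(E^{(-131)}/ℚ) = 5²` — the crux's SECOND
rank clause `ν = rank E(ℚ) = rank E^{(d_K)}(ℚ) − 1` at this curve, and `Ш[5] = 0` for the RANK-TWO
curve `E^{(-131)}` (conductor `N_E·131²`), which no first-sign row reaches through `K`. Side conditions:
`ρ̄_{E,5^m}` onto (`hasSurjectiveModNGaloisRep_pow_5`), non-CM, Heegner, Kolyvagin prime
(`card_29`), (KN_5) from `Δ(E₀) = -539` (`decide`-able table), `1 ≤ rank` (`one_le_rank`),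
`2 ≤ rank E^{(-131)}` (`two_le_rank_twist_neg131`) — all kernel theorems. CONDITIONAL on (γ) and the
bit; per-curve; BSD is not proved by it. [cite: Kolyvagin1991MathAnn, Thm. 2.3]
[cite: GrossLMS1991, Prop. 3.7 (2), §5 (5.1), Prop. 6.2 (1)] [cite: McCallumLMS1991, §§2–5]
[cite: JetchevLauterStein2009, §3.6 (arXiv:0707.0032)] -/
theorem depthRow_5_neg131_29_secondSign
    (h372 : GrossLMS1991.prop37_2_frobeniusCongruence)
    (K : Type) [Field K] [NumberField K] (hK : IsImaginaryQuadratic K)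
    (hD : NumberField.discr K = -131) :
    haveI := isElliptic;
    haveI := isGloballyMinimal;
    haveI : NeZero (((⟨0, 0, 1, 2, 0⟩ : WeierstrassCurve ℤ).map (Int.castRingHom ℚ)).conductorNorm ℤ) := neZero_conductorNorm_of_isElliptic _;
    ∀ (Dt : ModularParametrizationData ((⟨0, 0, 1, 2, 0⟩ : WeierstrassCurve ℤ).map (Int.castRingHom ℚ)) (((⟨0, 0, 1, 2, 0⟩ : WeierstrassCurve ℤ).map (Int.castRingHom ℚ)).conductorNorm ℤ)) (β : ℤ) (ι : K →+* ℂ)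
      (d : KolyvaginHeegnerData Dt β ι 29),
    d.kolyvaginClass (p := 5) (by norm_num) 1 ≠ 0 →
    ((⟨0, 0, 1, 2, 0⟩ : WeierstrassCurve ℤ).map (Int.castRingHom ℚ)).shaCorank 5 = 0 ∧ ((⟨0, 0, 1, 2, 0⟩ : WeierstrassCurve ℤ).map (Int.castRingHom ℚ)).mordellWeilRank = 1 ∧
      (((⟨0, 0, 1, 2, 0⟩ : WeierstrassCurve ℤ).map (Int.castRingHom ℚ)).quadraticTwist ((-131 : ℤ) : ℚ)).shaCorank 5 = 0 ∧
      (((⟨0, 0, 1, 2, 0⟩ : WeierstrassCurve ℤ).map (Int.castRingHom ℚ)).quadraticTwist ((-131 : ℤ) : ℚ)).mordellWeilRank = 2 ∧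
      (∀ P : ((⟨0, 0, 1, 2, 0⟩ : WeierstrassCurve ℤ).map (Int.castRingHom ℚ)).toAffine.Point, 5 • P = 0 → P = 0) ∧
      (∀ x ∈ ((⟨0, 0, 1, 2, 0⟩ : WeierstrassCurve ℤ).map (Int.castRingHom ℚ)).sha, 5 • x = 0 → x = 0) ∧
      Nat.card ↥(selmerGroup ((⟨0, 0, 1, 2, 0⟩ : WeierstrassCurve ℤ).map (Int.castRingHom ℚ)) ((5 : ℕ) : ℤ)) = 5 ∧
      (∀ x ∈ (((⟨0, 0, 1, 2, 0⟩ : WeierstrassCurve ℤ).map (Int.castRingHom ℚ)).quadraticTwist ((-131 : ℤ) : ℚ)).sha, 5 • x = 0 → x = 0) ∧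
      Nat.card ↥(selmerGroup (((⟨0, 0, 1, 2, 0⟩ : WeierstrassCurve ℤ).map (Int.castRingHom ℚ)).quadraticTwist ((-131 : ℤ) : ℚ)) ((5 : ℕ) : ℤ)) = 5 ^ 2 := by
  haveI := isElliptic
  haveI := isGloballyMinimal
  haveI : NeZero (((⟨0, 0, 1, 2, 0⟩ : WeierstrassCurve ℤ).map (Int.castRingHom ℚ)).conductorNorm ℤ) := neZero_conductorNorm_of_isElliptic _
  intro Dt β ι d hne
  haveI := Fact.mk (by norm_num : Nat.Prime 5)
  exact depthRowSecondSign_print_of_datum_of_intModel_certificate intModel h372 not_hasCM one_le_rank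
    5 (by norm_num) hasSurjectiveModNGaloisRep_pow_5 K hK hD (by norm_num) (by norm_num)
    twistModel_neg131 two_le_rank_twist_neg131 heegner_neg131 29 (by norm_num) (by norm_num)
    (by decide +kernel) (by norm_num) (by norm_num) (by norm_num) (by norm_num) (n := 20) card_29
    (by norm_num) (Δ₀ := -539) (by decide +kernel) (B := 11) (by decide +kernel) (by decide +kernel)
    (fun _ _ ↦ Or.inl (by norm_num)) Dt β ι d hne

end C77a1


end SecondSign

end Summit.BirchSwinnertonDyer.BirchSwinnertonDyer.Theorems.KolyvaginDepthDoor

end
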